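/-
Width seat `ym-line-cbag-p1-w3` (prover-ym-line-cbag-p1-w3-g8-0), the only seat on LINE 3 `route-QuantumFields-SixPlaneColdBox`, crux
`TorusMeanNearColdBoxG` (stmt-QuantumFields-25708), infrared stub: the ONE-SIDED EQUIPARTITION WITH A POWER RATE of the six-plane plaquette
energy over all torus-limit states, from the CLOSED crux `FreeEnergyRate` (stmt-QuantumFields-22402) by Griffiths' lemma.
-/
import Summits.QuantumFields.YangMills.Theorems.EntropyBudgetEquipartitionFreeEnergyRate
import Summits.QuantumFields.YangMills.Theorems.EquipartitionCriticalityEquipartitionPinsProbeEquipartition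

/-!
# Equipartition of the plaquette energy with a power rate, uniformly over torus-limit states

For every compact simple `G` and faithful unitary lattice representation `r` (`D = dim_ℝ 𝔤_r`):

* `SixPlaneColdBox.rate_squeeze_upper` — pure real analysis: if `|f(y) + c log y − K| ≤ C y^{−κ}` for `y ≥ y₀` (`c, C ≥ 0`, `κ > 0`), then for
  `β ≥ max (2y₀) 1` every `e` on a supporting line of `f` at `β` (`(β − y) e ≤ f y − f β` for all `y`) obeys
  `β e ≤ c + (c + 2C(2^κ + 1)) β^{−κ/2}` (take `y = β/(1+t)`, `t = β^{−κ/2}`, `log(1+t) ≤ t`);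
* `SixPlaneColdBox.equipartitionRate_upper` — there are `Cₑ, κ' > 0, β₁` with, for all `β ≥ β₁` and every
  `μ ∈ infiniteVolumeLimitPoints r.ρ β`, `β · E_μ[Σ_{i<j} (N − Re tr r(U_{(0;i,j)}))] ≤ 3D/2 + Cₑ β^{−κ'}`:
  the CLOSED crux `FreeEnergyRate` (`|f_r(β) + (3D/2) log β − K| ≤ C β^{−κ}`, `FreeEnergyRate.FreeEnergyRate_of`, Chatterjee's Theorem 2.1 with a
  power rate) and Griffiths' lemma (`EquipartitionPinsProbe.Equipartition.griffiths`: torus-limit energy densities are subgradients of the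
  pressure) fed to the rate squeeze.

This is the torus-side input of the infrared stub of crux `TorusMeanNearColdBoxG`.  No sorry; standard axioms.  NOT the Yang–Mills mass gap.
-/

set_option autoImplicit false

noncomputable section

open MeasureTheory Filter Topology
open Literature.MathematicalPhysics.QuantumLattice
open Literature.MathematicalPhysics.QuantumFieldTheory

namespace Summit.QuantumFields.YangMills.Theorems.SixPlaneColdBox

/-- **Rate squeeze (upper half).**  If `|f(y) + c·log y − K| ≤ C·y^{−κ}` for `y ≥ y₀` with `c, C ≥ 0`, `κ > 0`, then for `β ≥ max (2 y₀) 1`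
(and `β > 0`) every slope `e` of a supporting line of `f` at `β` satisfies `β·e ≤ c + (c + 2C(2^κ + 1))·β^{−κ/2}`. -/
theorem rate_squeeze_upper {f : ℝ → ℝ} {c K C κ y₀ : ℝ} (hc : 0 ≤ c) (hC : 0 ≤ C) (hκ : 0 < κ)
    (hf : ∀ y : ℝ, y₀ ≤ y → |f y + c * Real.log y - K| ≤ C * y ^ (-κ))
    {β : ℝ} (hβ0 : 0 < β) (hβ1 : 1 ≤ β) (hβy : 2 * y₀ ≤ β) {e : ℝ}
    (hsub : ∀ y : ℝ, (β - y) * e ≤ f y - f β) :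
    β * e ≤ c + (c + 2 * C * ((2 : ℝ) ^ κ + 1)) * β ^ (-(κ / 2)) := by
  set t : ℝ := β ^ (-(κ / 2)) with ht
  have ht0 : 0 < t := Real.rpow_pos_of_pos hβ0 _
  have ht1 : t ≤ 1 := Real.rpow_le_one_of_one_le_of_nonpos hβ1 (by linarith)
  have h1t : 0 < 1 + t := by linarith
  set y : ℝ := β / (1 + t) with hy
  have hy0 : 0 < y := div_pos hβ0 h1t
  have hyβ2 : β / 2 ≤ y := by
    rw [hy]; exact div_le_div_of_nonneg_left hβ0.le h1t (by linarith)
  have hyy₀ : y₀ ≤ y := by linarith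
  have hββ₀ : y₀ ≤ β := by linarith
  -- the two endpoint estimates
  have hfy := hf y hyy₀
  have hfβ := hf β hββ₀
  rw [abs_le] at hfy hfβ
  -- log bookkeeping: log β − log y = log (1+t) ≤ t
  have hlog : Real.log β - Real.log y = Real.log (1 + t) := by
    rw [hy, Real.log_div hβ0.ne' h1t.ne']; ring
  have hlog1 : Real.log (1 + t) ≤ t := by
    have := Real.log_le_sub_one_of_pos h1t; linarith
  -- y^{-κ} ≤ (β/2)^{-κ} = 2^κ β^{-κ}
  have hyk : y ^ (-κ) ≤ (2 : ℝ) ^ κ * β ^ (-κ) := by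
    have h1 : y ^ (-κ) ≤ (β / 2) ^ (-κ) := Real.rpow_le_rpow_of_nonpos (by positivity) hyβ2 (by linarith)
    have h2 : (β / 2) ^ (-κ) = (2 : ℝ) ^ κ * β ^ (-κ) := by
      rw [Real.div_rpow hβ0.le (by norm_num), Real.rpow_neg (by norm_num : (0 : ℝ) ≤ 2), div_eq_mul_inv, inv_inv, mul_comm]
    rw [← h2]; exact h1
  -- the supporting line at `y = β/(1+t)`
  have hs := hsub y
  have hβy' : β - y = β * t / (1 + t) := by rw [hy]; field_simp; ring
  have hdiff : f y - f β ≤ c * t + C * ((2 : ℝ) ^ κ + 1) * β ^ (-κ) := by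
    have e1 : f y - f β ≤ c * (Real.log β - Real.log y) + C * y ^ (-κ) + C * β ^ (-κ) := by linarith
    rw [hlog] at e1
    have e2 : c * Real.log (1 + t) ≤ c * t := mul_le_mul_of_nonneg_left hlog1 hc
    have e3 : C * y ^ (-κ) ≤ C * ((2 : ℝ) ^ κ * β ^ (-κ)) := mul_le_mul_of_nonneg_left hyk hC
    linarith
  rw [hβy'] at hs
  -- `β t/(1+t) · e ≤ c t + C(2^κ+1) β^{-κ}` ⇒ `β e ≤ (1+t)(c + C(2^κ+1) β^{-κ}/t)`
  have hβk : β ^ (-κ) = t * t := by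
    rw [ht, ← Real.rpow_add hβ0]; ring_nf
  have key : β * e * t ≤ (1 + t) * (c * t + C * ((2 : ℝ) ^ κ + 1) * (t * t)) := by
    rw [← hβk]
    have : β * t / (1 + t) * e * (1 + t) = β * e * t := by field_simp
    have h2 := mul_le_mul_of_nonneg_right (hs.trans hdiff) h1t.le
    rw [this] at h2
    linarith
  -- divide by `t > 0`
  have key2 : β * e ≤ (1 + t) * (c + C * ((2 : ℝ) ^ κ + 1) * t) := by
    have : (1 + t) * (c * t + C * ((2 : ℝ) ^ κ + 1) * (t * t)) = ((1 + t) * (c + C * ((2 : ℝ) ^ κ + 1) * t)) * t := by ring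
    rw [this] at key
    exact le_of_mul_le_mul_right key ht0
  have h2k : 0 ≤ (2 : ℝ) ^ κ := by positivity
  have hCt : 0 ≤ C * ((2 : ℝ) ^ κ + 1) * t := by positivity
  nlinarith [key2, ht1, hCt, mul_nonneg hc ht0.le]

/-- **One-sided equipartition of the six-plane plaquette energy with a power rate, uniformly over torus-limit states.**  For every compact
simple `G` and faithful unitary lattice representation `r` there are `Cₑ`, `κ' > 0`, `β₁` such that for all `β ≥ β₁` and every
`μ ∈ infiniteVolumeLimitPoints r.ρ β`: `β · E_μ[Σ_{i<j}(N − Re tr r(U_{(0;i,j)}))] ≤ 3D/2 + Cₑ β^{−κ'}`, `D = dim_ℝ 𝔤_r`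
(`FreeEnergyRate` + Griffiths' lemma + `rate_squeeze_upper`). -/
theorem equipartitionRate_upper
    (G : Type) [Group G] [TopologicalSpace G] [IsTopologicalGroup G] [CompactSpace G] (hG : IsCompactSimpleLieGroup G) :
    letI : MeasurableSpace G := borel G
    haveI : BorelSpace G := ⟨rfl⟩
    ∀ r : LatticeRep G, ∃ Cₑ κ' β₁ : ℝ, 0 < κ' ∧ ∀ β : ℝ, β₁ ≤ β →
      ∀ μ ∈ infiniteVolumeLimitPoints (d := 4) r.ρ β,
        β * (∫ U, (∑ i : Fin 4, ∑ j : Fin 4, if i < j then ((r.N : ℝ) - plaquetteObs r.ρ 0 i j U) else 0) ∂μ) ≤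
          3 * (Module.finrank ℝ ↥(Submodule.span ℝ {X : Matrix (Fin r.N) (Fin r.N) ℂ |
            ∀ t : ℝ, NormedSpace.exp ((t : ℂ) • X) ∈ Set.range r.ρ}) : ℝ) / 2 + Cₑ * β ^ (-κ') := by
  letI : MeasurableSpace G := borel G
  haveI : BorelSpace G := ⟨rfl⟩
  intro r
  haveI : SecondCountableTopology G := (r.continuous.isClosedEmbedding r.injective).isEmbedding.secondCountableTopology
  obtain ⟨K, κ, C, β₀, hκ, hrate⟩ := FreeEnergyRate.FreeEnergyRate_of G hG r
  set c : ℝ := 3 * (Module.finrank ℝ ↥(Submodule.span ℝ {X : Matrix (Fin r.N) (Fin r.N) ℂ |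
    ∀ t : ℝ, NormedSpace.exp ((t : ℂ) • X) ∈ Set.range r.ρ}) : ℝ) / 2 with hc
  have hc0 : 0 ≤ c := by positivity
  -- `C ≥ 0` and `y₀ ≥ 1` may be assumed
  have hrate' : ∀ y : ℝ, max β₀ 1 ≤ y → |freeEnergyDensity 4 r.ρ y + c * Real.log y - K| ≤ max C 0 * y ^ (-κ) := by
    intro y hy
    have hy0 : 0 ≤ y := by linarith [(le_max_right β₀ 1).trans hy]
    exact (hrate y ((le_max_left _ _).trans hy)).trans (mul_le_mul_of_nonneg_right (le_max_left _ _) (Real.rpow_nonneg hy0 _))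
  refine ⟨c + 2 * max C 0 * ((2 : ℝ) ^ κ + 1), κ / 2, max (2 * max β₀ 1) 1, by positivity, fun β hβ μ hμ => ?_⟩
  simp only [max_le_iff] at hβ
  obtain ⟨hβy, hβ1⟩ := hβ
  have hβ0 : 0 < β := by linarith
  have hsub := fun y : ℝ => EquipartitionPinsProbe.Equipartition.griffiths (d := 4) r.ρ r.continuous hμ y
  exact rate_squeeze_upper (K := K) hc0 (le_max_right C 0) hκ hrate' hβ0 hβ1 hβy hsub

end Summit.QuantumFields.YangMills.Theorems.SixPlaneColdBox

end
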